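import Literature.NumberTheory.EllipticCurves.Rank1Residual.X9MuInvariant
import Literature.NumberTheory.EllipticCurves.Rank1Residual.X9TrivialPartner
import Literature.NumberTheory.EllipticCurves.YanZhu2026.CyclotomicMainTheoremRational
import HarnessLib

/-!
# BSD rank-≤1 residual cell — the μ-typing and route U2′ at an arbitrary ODD good ordinary prime,
# from the RATIONAL main conjecture as a pointwise hypothesis; class X10b (`p = 3`), rank 0

HONEST FRAMING (cell `b2b-bsdres-*`, verbatim): the goal of the cell is to DELETE the
COMBINATION-SHAPED residual classes for ALL analytic-rank ≤ 1 curves over ℚ — "full BSD formula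
for every rank ≤ 1 curve in class C" assembled STRICTLY from published theorems — so that the
rank-≤1 remainder becomes exactly the CONSTRUCTION-SHAPED classes, which are TYPED (missing-input
Props), NOT attempted; this is not "finishing BSD".

Theorems only (X9 prover gen 5). `X9MuInvariant.lean` proved, at `p ≥ 5` from
Burungale–Castella–Skinner 2025 Thm. 1.1.2 (a): (i) on X9 ∧ `r_an = 0`, granted one unit coefficient
of `𝓛_MSD(E)`, `BSD(E,p) ⟺ μ(X(E/ℚ_∞)) = 0`; (ii) route U2′: `BSD(A,p)` for a congruent rank-0
partner `A` with `μ(𝓛_p(A)) = 0` certified transfers to `E`. The only input printed for `p > 3`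
there is BCS (a) — the RATIONAL main conjecture `char X = (p^k · L_p)`. This file re-proves both with
that statement as an explicit POINTWISE hypothesis `hrat` for the curve at hand ("`X(W/ℚ_∞)` is
torsion and `char X = (g)`, `ι g = p^k L_p(f, α)` for some `k ∈ ℤ`, for all cyclotomic data and
newforms"), valid verbatim at every odd good ordinary prime with `E[p]` irreducible — so that it can
be fed by BCS (a) (`p ≥ 5`), by Yan–Zhu, J. Algebra (2026) Thm. 4.9 (`p ≥ 3`; named fact
`YanZhu2026.thm49_charIdeal_eq_padicLFunction`, proposed p187100, flag `YZ26@3-BF-ERL-Ohta`), or by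
any later source — and specialises to class **X10b** (`ClassX10 W p`: `p = 3`, good ordinary,
`E[3]` irreducible; `ρ̄_{E,3}` not surjective), analytic rank `0`:

* `mazurMainConjecture_of_mu_eq_zero_of_rationalMC`, `mazurMainConjecture_neron_of_mu_eq_zero_of_rationalMC`;
* `bsdp_of_mu_eq_zero_of_rationalMC` (rank 0), `mu_eq_zero_of_bsdp_of_rationalMC` (converse),
  `bsdp_iff_mu_eq_zero_of_rationalMC`;
* `mazurMainConjecture_with_mu_zero_of_bsdp_of_rationalMC` (U2′ partner side),
  `bsdp_of_bsdpPartner_of_rationalMC` (rank 0);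
* X10b wrappers: `X10b.bsdp_iff_mu_eq_zero`, `X10b.bsdp_of_bsdpPartner`,
  `X10b.bsdp_of_bsdpPartner_of_conductor_lt` (Kraus–Oesterlé list + Miller partner),
  `X10b.missingInputAt_of_bsdpPartner`.

The rank-1 half of X10b is NOT touched (the rank-one engine needs `p ≥ 5`). No pair is closed by
these theorems; class labels unchanged.
-/

set_option autoImplicit false

noncomputable section

open scoped Classical MatrixGroups ModularForm

open CongruenceSubgroup WeierstrassCurve Literature.NumberTheory.EllipticCurves
  Literature.NumberTheory.EllipticCurves.ModularForms

namespace Literature.NumberTheory.EllipticCurves.Rank1Residual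

section RationalMC

variable (W : WeierstrassCurve ℚ) [W.IsElliptic] [W.IsGloballyMinimal] (p : ℕ) [Fact p.Prime]

/-- **`μ = 0` + certificate ⟹ the integral main conjecture, from the RATIONAL main conjecture for
`(W, p)` (pointwise hypothesis `hrat`)**, at an odd good ordinary prime with `E[p]` irreducible.
As `mazurMainConjecture_of_mu_eq_zero` with BCS (a) replaced by `hrat`. [cite: GreenbergVatsal2000, Prop. 3.7]
[cite: GreenbergLNM1716, §1 Conj. 1.11] -/
theorem mazurMainConjecture_of_mu_eq_zero_of_rationalMC
    (hrat : ∀ (κ : ZpExtension ℚ p) (γ : Field.absoluteGaloisGroup ℚ) {N : ℕ} [NeZero N]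
      (f : CuspForm (Gamma0 N) 2), κ.IsCyclotomic → κ.IsTopGenerator γ → IsCyclotomicVariable p γ →
      IsNewformOf W f → ∀ (D : W.SelmerDualData κ γ), D.IsTorsion ∧
        ∃ (g : IwasawaAlgebra p) (k : ℤ), D.charIdeal = Ideal.span {g} ∧
          iwasawaToPowerSeries p g =
            PowerSeries.C ((p : ℚ_[p]) ^ k) * padicLFunction f (unitRoot W p : ℚ_[p]))
    (hp : p ≠ 2) (hgood : W.HasGoodReductionAtPrime p) (hord : ¬ (p : ℤ) ∣ W.frobeniusTrace p)
    (hirr : W.HasIrreducibleModPGaloisRep p)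
    (κ : ZpExtension ℚ p) (γ : Field.absoluteGaloisGroup ℚ) (hκ : κ.IsCyclotomic)
    (hγ : κ.IsTopGenerator γ) (hγ' : IsCyclotomicVariable p γ)
    {N : ℕ} [NeZero N] (f : CuspForm (Gamma0 N) 2) (hf : IsNewformOf W f)
    (D : W.SelmerDualData κ γ) (hμ : D.mu = 0)
    (hcert : ∃ n : ℕ, ‖PowerSeries.coeff n (padicLFunction f (unitRoot W p : ℚ_[p]))‖ = 1) :
    D.IsTorsion ∧
      ∃ g : IwasawaAlgebra p, D.charIdeal = Ideal.span {g} ∧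
        iwasawaToPowerSeries p g = padicLFunction f (unitRoot W p : ℚ_[p]) := by
  have hordp : IsOrdinaryAt W p := ⟨hgood, hord⟩
  haveI : Module.Finite (IwasawaAlgebra p) D.X := D.module_finite_holds hγ
  obtain ⟨hX, g, k, hchar, hιg⟩ := hrat κ γ f hκ hγ hγ' hf D
  have hg : GreenbergVatsal2000.HasUnitContent g :=
    (GreenbergVatsal2000.mu_eq_zero_iff_hasUnitContent D hX hchar).mp hμ
  have hint : ∀ n : ℕ, ‖PowerSeries.coeff n (padicLFunction f (unitRoot W p : ℚ_[p]))‖ ≤ 1 := by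
    intro n
    rw [coeff_padicLFunction]
    exact padicLFunction_mem_integral_holds hp hordp hf hirr n
  have hk : k = 0 := exponent_eq_zero_of_hasUnitContent g _ k hιg hint hcert hg
  refine ⟨hX, g, hchar, ?_⟩
  rw [hιg, hk, zpow_zero, map_one, one_mul]

/-- **Mazur's main conjecture for `(E, p)` in the Néron normalisation from `μ = 0`, the certificate
and the rational main conjecture `hrat`**, at any odd good ordinary prime with `E[p]` irreducible;
period unit from `h5` (`p ≥ 5`) / `h3` (`p = 3`). As `mazurMainConjecture_neron_of_mu_eq_zero`.
[cite: GreenbergVatsal2000, Prop. 3.7 and §3 Remark (3.4)] -/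
theorem mazurMainConjecture_neron_of_mu_eq_zero_of_rationalMC
    (hrat : ∀ (κ : ZpExtension ℚ p) (γ : Field.absoluteGaloisGroup ℚ) {N : ℕ} [NeZero N]
      (f : CuspForm (Gamma0 N) 2), κ.IsCyclotomic → κ.IsTopGenerator γ → IsCyclotomicVariable p γ →
      IsNewformOf W f → ∀ (D : W.SelmerDualData κ γ), D.IsTorsion ∧
        ∃ (g : IwasawaAlgebra p) (k : ℤ), D.charIdeal = Ideal.span {g} ∧
          iwasawaToPowerSeries p g =
            PowerSeries.C ((p : ℚ_[p]) ^ k) * padicLFunction f (unitRoot W p : ℚ_[p]))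
    (h5 : realPeriodRat_eq_unit_mul_plusPeriod) (h3 : realPeriodRat_eq_unit_mul_plusPeriod_three)
    (hp : p ≠ 2) (hgood : W.HasGoodReductionAtPrime p) (hord : ¬ (p : ℤ) ∣ W.frobeniusTrace p)
    (hirr : W.HasIrreducibleModPGaloisRep p)
    (hμ : ∀ (κ : ZpExtension ℚ p) (γ : Field.absoluteGaloisGroup ℚ),
        κ.IsCyclotomic → κ.IsTopGenerator γ → IsCyclotomicVariable p γ →
      ∀ (D : W.SelmerDualData κ γ), D.mu = 0)
    (hcert : ∀ [NeZero (W.conductorNorm ℤ)] (f : CuspForm (Gamma0 (W.conductorNorm ℤ)) 2),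
        IsNewformOf W f → ∀ (ϖ : ℚ), (ϖ : ℝ) * W.realPeriodRat = plusPeriod f →
      ∃ n : ℕ, ‖PowerSeries.coeff n
        (PowerSeries.C (ϖ : ℚ_[p]) * padicLFunction f (unitRoot W p : ℚ_[p]))‖ = 1) :
    ∀ (κ : ZpExtension ℚ p) (γ : Field.absoluteGaloisGroup ℚ),
        κ.IsCyclotomic → κ.IsTopGenerator γ → IsCyclotomicVariable p γ →
      ∀ [NeZero (W.conductorNorm ℤ)] (f : CuspForm (Gamma0 (W.conductorNorm ℤ)) 2),
        IsNewformOf W f → ∀ (ϖ : ℚ), (ϖ : ℝ) * W.realPeriodRat = plusPeriod f →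
      ∀ (D : W.SelmerDualData κ γ), D.IsTorsion ∧
        ∃ g : IwasawaAlgebra p, D.charIdeal = Ideal.span {g} ∧
          iwasawaToPowerSeries p g =
            PowerSeries.C (ϖ : ℚ_[p]) * padicLFunction f (unitRoot W p : ℚ_[p]) := by
  intro κ γ hκ hγ hγ' _ f hf ϖ hϖeq D
  have hϖnorm : ‖(ϖ : ℚ_[p])‖ = 1 :=
    norm_periodRatio_eq_one_of_odd h5 h3 W p hp hgood hirr f hf ϖ hϖeq
  have hcert' : ∃ n : ℕ, ‖PowerSeries.coeff n (padicLFunction f (unitRoot W p : ℚ_[p]))‖ = 1 := by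
    obtain ⟨n, hn⟩ := hcert f hf ϖ hϖeq
    refine ⟨n, ?_⟩
    rwa [PowerSeries.coeff_C_mul, norm_mul, hϖnorm, one_mul] at hn
  obtain ⟨hX, g, hchar, hιg⟩ := mazurMainConjecture_of_mu_eq_zero_of_rationalMC W p hrat hp hgood
    hord hirr κ γ hκ hγ hγ' f hf D (hμ κ γ hκ hγ hγ' D) hcert'
  set c : ℤ_[p] := ⟨(ϖ : ℚ_[p]), hϖnorm.le⟩ with hc_def
  have hcu : IsUnit c := PadicInt.isUnit_iff.mpr hϖnorm
  refine ⟨hX, PowerSeries.C c * g, ?_, ?_⟩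
  · rw [hchar]
    exact (Ideal.span_singleton_mul_left_unit (hcu.map PowerSeries.C) g).symm
  · rw [map_mul, hιg, PowerSeries.map_C]
    rfl

/-- **Analytic rank 0 at any odd good ordinary irreducible prime: `μ = 0` (OPEN, per pair) +
certificate + rational main conjecture ⟹ `BSD(E,p)`.** PUBLISHED binders: Greenberg LNM 1716
Thm. 4.1 (`hGr`), period unit (`h5`, `h3`), modularity (`hmodP`, `hmodL`), GZK (`hGZK`); `hrat` is
the rational main conjecture for `(W, p)` (BCS 2025 (a) at `p ≥ 5`, Yan–Zhu 2026 Thm. 4.9 at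
`p ≥ 3`). [cite: GreenbergLNM1716, Thm. 4.1 (p. 102) and §1 Conj. 1.11]
[cite: CastellaEtAl2021, Thm. 5.1.4 and its proof (§5.1.3)] -/
theorem bsdp_of_mu_eq_zero_of_rationalMC
    (hrat : ∀ (κ : ZpExtension ℚ p) (γ : Field.absoluteGaloisGroup ℚ) {N : ℕ} [NeZero N]
      (f : CuspForm (Gamma0 N) 2), κ.IsCyclotomic → κ.IsTopGenerator γ → IsCyclotomicVariable p γ →
      IsNewformOf W f → ∀ (D : W.SelmerDualData κ γ), D.IsTorsion ∧
        ∃ (g : IwasawaAlgebra p) (k : ℤ), D.charIdeal = Ideal.span {g} ∧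
          iwasawaToPowerSeries p g =
            PowerSeries.C ((p : ℚ_[p]) ^ k) * padicLFunction f (unitRoot W p : ℚ_[p]))
    (hGr : greenberg_charValue_rankZero) (h5 : realPeriodRat_eq_unit_mul_plusPeriod)
    (h3 : realPeriodRat_eq_unit_mul_plusPeriod_three)
    (hmodP : nonempty_modularParametrizationData) (hmodL : hasEntireLFunction_rat)
    (hGZK : rank_eq_analyticRank_of_analyticRank_le_one)
    (hp : p ≠ 2) (hgood : W.HasGoodReductionAtPrime p) (hord : ¬ (p : ℤ) ∣ W.frobeniusTrace p)
    (hirr : W.HasIrreducibleModPGaloisRep p) (hr : W.analyticRank = 0)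
    (hμ : ∀ (κ : ZpExtension ℚ p) (γ : Field.absoluteGaloisGroup ℚ),
        κ.IsCyclotomic → κ.IsTopGenerator γ → IsCyclotomicVariable p γ →
      ∀ (D : W.SelmerDualData κ γ), D.mu = 0)
    (hcert : ∀ [NeZero (W.conductorNorm ℤ)] (f : CuspForm (Gamma0 (W.conductorNorm ℤ)) 2),
        IsNewformOf W f → ∀ (ϖ : ℚ), (ϖ : ℝ) * W.realPeriodRat = plusPeriod f →
      ∃ n : ℕ, ‖PowerSeries.coeff n
        (PowerSeries.C (ϖ : ℚ_[p]) * padicLFunction f (unitRoot W p : ℚ_[p]))‖ = 1) :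
    BSDp W p := by
  have hL : W.entireLFunction 1 ≠ 0 := (W.analyticRank_eq_zero_iff_holds (hmodL W)).1 hr
  have hfin : Finite W.sha := (hGZK W (by omega)).2
  exact bsdp_of_padicValRat_rank_zero W p hr hL hGZK
    (padicValRat_bsd_rank_zero_of_mazurMainConjecture W p hgood hord hL hfin hmodP
      (hGr W p hp hgood hord)
      (mazurMainConjecture_neron_of_mu_eq_zero_of_rationalMC W p hrat h5 h3 hp hgood hord hirr hμ
        hcert))

/-- **Analytic rank 0, CONVERSE: `BSD(E,p)` + certificate + rational main conjecture ⟹ `μ = 0` for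
every cyclotomic dual datum**, at any odd good ordinary irreducible prime. As `X9.mu_eq_zero_of_bsdp`
with BCS (a) replaced by `hrat` and the class predicate by its used conjuncts.
[cite: CastellaEtAl2021, Thm. 5.1.4 and its proof (§5.1.3)] [cite: Miller2011LMS, Def. 1.1] -/
theorem mu_eq_zero_of_bsdp_of_rationalMC
    (hrat : ∀ (κ : ZpExtension ℚ p) (γ : Field.absoluteGaloisGroup ℚ) {N : ℕ} [NeZero N]
      (f : CuspForm (Gamma0 N) 2), κ.IsCyclotomic → κ.IsTopGenerator γ → IsCyclotomicVariable p γ →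
      IsNewformOf W f → ∀ (D : W.SelmerDualData κ γ), D.IsTorsion ∧
        ∃ (g : IwasawaAlgebra p) (k : ℤ), D.charIdeal = Ideal.span {g} ∧
          iwasawaToPowerSeries p g =
            PowerSeries.C ((p : ℚ_[p]) ^ k) * padicLFunction f (unitRoot W p : ℚ_[p]))
    (hGr : greenberg_charValue_rankZero) (h5 : realPeriodRat_eq_unit_mul_plusPeriod)
    (h3 : realPeriodRat_eq_unit_mul_plusPeriod_three)
    (hmodP : nonempty_modularParametrizationData) (hmodL : hasEntireLFunction_rat)
    (hGZK : rank_eq_analyticRank_of_analyticRank_le_one)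
    (hp : p ≠ 2) (hgood : W.HasGoodReductionAtPrime p) (hord : ¬ (p : ℤ) ∣ W.frobeniusTrace p)
    (hirr : W.HasIrreducibleModPGaloisRep p) (hr : W.analyticRank = 0) (hbsd : BSDp W p)
    (hcert : ∀ [NeZero (W.conductorNorm ℤ)] (f : CuspForm (Gamma0 (W.conductorNorm ℤ)) 2),
        IsNewformOf W f → ∀ (ϖ : ℚ), (ϖ : ℝ) * W.realPeriodRat = plusPeriod f →
      ∃ n : ℕ, ‖PowerSeries.coeff n
        (PowerSeries.C (ϖ : ℚ_[p]) * padicLFunction f (unitRoot W p : ℚ_[p]))‖ = 1) :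
    ∀ (κ : ZpExtension ℚ p) (γ : Field.absoluteGaloisGroup ℚ),
        κ.IsCyclotomic → κ.IsTopGenerator γ → IsCyclotomicVariable p γ →
      ∀ (D : W.SelmerDualData κ γ), D.mu = 0 := by
  intro κ γ hκ hγ hγ' D
  have hpP : p.Prime := Fact.out
  have hL : W.entireLFunction 1 ≠ 0 := (W.analyticRank_eq_zero_iff_holds (hmodL W)).1 hr
  have hfin : Finite W.sha := (hGZK W (by omega)).2
  haveI : NeZero (W.conductorNorm ℤ) := ⟨(W.conductorNorm_pos_holds).ne'⟩
  obtain ⟨Dm⟩ := hmodP W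
  have hf : IsNewformOf W Dm.f := Dm.isNewformOf
  obtain ⟨ϖ, hϖpos, hϖeq, -⟩ := Dm.exists_rat_mul_realPeriodRat_eq_plusPeriod
  have hϖnorm : ‖(ϖ : ℚ_[p])‖ = 1 :=
    norm_periodRatio_eq_one_of_odd h5 h3 W p hp hgood hirr Dm.f hf ϖ hϖeq
  have hϖv : padicValRat p ϖ = 0 := by
    have h := Padic.norm_eq_zpow_neg_valuation (show ((ϖ : ℚ) : ℚ_[p]) ≠ 0 by exact_mod_cast hϖpos.ne')
    rw [hϖnorm, Padic.valuation_ratCast] at h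
    have hp1 : (1 : ℝ) < p := by exact_mod_cast hpP.one_lt
    have h0 : (p : ℝ) ^ (0 : ℤ) = (p : ℝ) ^ (-padicValRat p ϖ) := by rw [zpow_zero]; exact h
    have := zpow_right_injective₀ (zero_lt_one.trans hp1) hp1.ne' h0
    omega
  obtain ⟨hX, g, k, hchar, hιg⟩ := hrat κ γ Dm.f hκ hγ hγ' hf D
  obtain ⟨t, htq, hval⟩ := padicValRat_lvalue_add_exponent_of_charIdeal_eq W p hgood hord hL hfin
    (hGr W p hp hgood hord) κ γ hκ hγ hγ' Dm.f hf ϖ hϖeq hϖv D hX g k hchar hιg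
  obtain ⟨hrank, hfinp, q', hsha, hvq'⟩ := hbsd
  haveI := hfinp
  have hΩC : (W.realPeriodRat : ℂ) ≠ 0 := Complex.ofReal_ne_zero.mpr W.realPeriodRat_pos_holds.ne'
  have hT : 0 < W.torsionOrder := W.torsionOrder_pos_holds
  have hc : 0 < W.tamagawaProduct := W.tamagawaProduct_pos'
  have hT0 : (W.torsionOrder : ℚ) ≠ 0 := by exact_mod_cast hT.ne'
  have hc0 : (W.tamagawaProduct : ℚ) ≠ 0 := by exact_mod_cast hc.ne'
  have hr0 : W.mordellWeilRank = 0 := hrank.trans hr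
  have hReg : W.regulator = 1 := W.regulator_eq_one_of_rank_zero hr0
  have hL1 : W.entireLFunction 1 = (t : ℂ) * (W.realPeriodRat : ℂ) := by
    rw [← htq, div_mul_cancel₀ _ hΩC]
  have ht0 : t ≠ 0 := by
    rintro rfl
    apply hL
    rw [hL1]
    simp
  have hq' : q' = t * (W.torsionOrder : ℚ) ^ 2 / (W.tamagawaProduct : ℚ) := by
    have h : shaAn W = ((t * (W.torsionOrder : ℚ) ^ 2 / (W.tamagawaProduct : ℚ) : ℚ) : ℂ) := by
      rw [shaAn_def, W.leadingLCoeff_eq_of_analyticRank_eq_zero hr, hL1, hReg]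
      have hcC : ((W.tamagawaProduct : ℚ) : ℂ) ≠ 0 := by exact_mod_cast hc.ne'
      push_cast
      field_simp
    rw [hsha] at h
    exact_mod_cast h
  rw [hq', padicValRat.div (mul_ne_zero ht0 (pow_ne_zero 2 hT0)) hc0,
    padicValRat.mul ht0 (pow_ne_zero 2 hT0), padicValRat.pow,
    padicValNat_card_addPrimaryComponent (A := W.sha) p, padicValRat.of_nat, padicValRat.of_nat] at hvq'
  simp only [WeierstrassCurve.shaOrder] at hval
  simp only [Nat.cast_ofNat] at hvq'
  have hk : k = 0 := by linarith
  rw [hk, zpow_zero, map_one, one_mul] at hιg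
  obtain ⟨n, hn⟩ := hcert Dm.f hf ϖ hϖeq
  rw [PowerSeries.coeff_C_mul, norm_mul, hϖnorm, one_mul] at hn
  exact mu_eq_zero_of_charIdeal_eq hγ D hX g hchar _ hιg ⟨n, hn⟩

/-- **Analytic rank 0 at any odd good ordinary irreducible prime: `BSD(E,p) ⟺ μ(X(E/ℚ_∞)) = 0`**,
granted the certificate and the rational main conjecture for `(W, p)`.
[cite: GreenbergLNM1716, §1 Conj. 1.11 and Thm. 4.1 (p. 102)] [cite: CastellaEtAl2021, Thm. 5.1.4 and its proof (§5.1.3)] -/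
theorem bsdp_iff_mu_eq_zero_of_rationalMC
    (hrat : ∀ (κ : ZpExtension ℚ p) (γ : Field.absoluteGaloisGroup ℚ) {N : ℕ} [NeZero N]
      (f : CuspForm (Gamma0 N) 2), κ.IsCyclotomic → κ.IsTopGenerator γ → IsCyclotomicVariable p γ →
      IsNewformOf W f → ∀ (D : W.SelmerDualData κ γ), D.IsTorsion ∧
        ∃ (g : IwasawaAlgebra p) (k : ℤ), D.charIdeal = Ideal.span {g} ∧
          iwasawaToPowerSeries p g =
            PowerSeries.C ((p : ℚ_[p]) ^ k) * padicLFunction f (unitRoot W p : ℚ_[p]))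
    (hGr : greenberg_charValue_rankZero) (h5 : realPeriodRat_eq_unit_mul_plusPeriod)
    (h3 : realPeriodRat_eq_unit_mul_plusPeriod_three)
    (hmodP : nonempty_modularParametrizationData) (hmodL : hasEntireLFunction_rat)
    (hGZK : rank_eq_analyticRank_of_analyticRank_le_one)
    (hp : p ≠ 2) (hgood : W.HasGoodReductionAtPrime p) (hord : ¬ (p : ℤ) ∣ W.frobeniusTrace p)
    (hirr : W.HasIrreducibleModPGaloisRep p) (hr : W.analyticRank = 0)
    (hcert : ∀ [NeZero (W.conductorNorm ℤ)] (f : CuspForm (Gamma0 (W.conductorNorm ℤ)) 2),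
        IsNewformOf W f → ∀ (ϖ : ℚ), (ϖ : ℝ) * W.realPeriodRat = plusPeriod f →
      ∃ n : ℕ, ‖PowerSeries.coeff n
        (PowerSeries.C (ϖ : ℚ_[p]) * padicLFunction f (unitRoot W p : ℚ_[p]))‖ = 1) :
    BSDp W p ↔
      ∀ (κ : ZpExtension ℚ p) (γ : Field.absoluteGaloisGroup ℚ),
        κ.IsCyclotomic → κ.IsTopGenerator γ → IsCyclotomicVariable p γ →
      ∀ (D : W.SelmerDualData κ γ), D.mu = 0 :=
  ⟨fun hbsd => mu_eq_zero_of_bsdp_of_rationalMC W p hrat hGr h5 h3 hmodP hmodL hGZK hp hgood hord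
      hirr hr hbsd hcert,
    fun hμ => bsdp_of_mu_eq_zero_of_rationalMC W p hrat hGr h5 h3 hmodP hmodL hGZK hp hgood hord hirr
      hr hμ hcert⟩

/-- **Route U2′, partner side, from the rational main conjecture for `(A, p)`**: `BSD(A,p)` in
analytic rank `0` + one unit coefficient of `𝓛_MSD(A)` ⟹ Mazur's main conjecture for `(A, p)`
integrally with `μ = 0`, at any odd good ordinary prime with `A[p]` irreducible.
[cite: CastellaEtAl2021, Thm. 5.1.4 and its proof (§5.1.3)] [cite: Miller2011LMS, Def. 1.1] -/
theorem mazurMainConjecture_with_mu_zero_of_bsdp_of_rationalMC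
    (A : WeierstrassCurve ℚ) [A.IsElliptic] [A.IsGloballyMinimal]
    (hratA : ∀ (κ : ZpExtension ℚ p) (γ : Field.absoluteGaloisGroup ℚ) {N : ℕ} [NeZero N]
      (f : CuspForm (Gamma0 N) 2), κ.IsCyclotomic → κ.IsTopGenerator γ → IsCyclotomicVariable p γ →
      IsNewformOf A f → ∀ (D : A.SelmerDualData κ γ), D.IsTorsion ∧
        ∃ (g : IwasawaAlgebra p) (k : ℤ), D.charIdeal = Ideal.span {g} ∧
          iwasawaToPowerSeries p g =
            PowerSeries.C ((p : ℚ_[p]) ^ k) * padicLFunction f (unitRoot A p : ℚ_[p]))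
    (hGr : greenberg_charValue_rankZero) (h5 : realPeriodRat_eq_unit_mul_plusPeriod)
    (h3 : realPeriodRat_eq_unit_mul_plusPeriod_three)
    (hmodL : hasEntireLFunction_rat) (hGZK : rank_eq_analyticRank_of_analyticRank_le_one)
    (hp : p ≠ 2) (hgood : A.HasGoodReductionAtPrime p) (hord : ¬ (p : ℤ) ∣ A.frobeniusTrace p)
    (hirr : A.HasIrreducibleModPGaloisRep p) (hrA : A.analyticRank = 0) (hbsd : BSDp A p)
    (hcert : ∀ [NeZero (A.conductorNorm ℤ)] (fA : CuspForm (Gamma0 (A.conductorNorm ℤ)) 2),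
        IsNewformOf A fA → ∀ (ϖ : ℚ), (ϖ : ℝ) * A.realPeriodRat = plusPeriod fA →
      ∃ n : ℕ, ‖PowerSeries.coeff n
        (PowerSeries.C (ϖ : ℚ_[p]) * padicLFunction fA (unitRoot A p : ℚ_[p]))‖ = 1) :
    ∀ (κ : ZpExtension ℚ p) (γ : Field.absoluteGaloisGroup ℚ),
        κ.IsCyclotomic → κ.IsTopGenerator γ → IsCyclotomicVariable p γ →
      ∀ [NeZero (A.conductorNorm ℤ)] (fA : CuspForm (Gamma0 (A.conductorNorm ℤ)) 2),
        IsNewformOf A fA → ∀ (ϖ : ℚ), (ϖ : ℝ) * A.realPeriodRat = plusPeriod fA →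
      ∀ (D : A.SelmerDualData κ γ), D.IsTorsion ∧
        ∃ g : IwasawaAlgebra p, D.charIdeal = Ideal.span {g} ∧
          GreenbergVatsal2000.HasUnitContent g ∧
          iwasawaToPowerSeries p g =
            PowerSeries.C (ϖ : ℚ_[p]) * padicLFunction fA (unitRoot A p : ℚ_[p]) := by
  intro κ γ hκ hγ hγ' _ fA hf ϖ hϖeq D
  have hpP : p.Prime := Fact.out
  have hL : A.entireLFunction 1 ≠ 0 := (A.analyticRank_eq_zero_iff_holds (hmodL A)).1 hrA
  have hfin : Finite A.sha := (hGZK A (by omega)).2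
  have hϖnorm : ‖(ϖ : ℚ_[p])‖ = 1 := norm_periodRatio_eq_one_of_odd h5 h3 A p hp hgood hirr fA hf ϖ hϖeq
  have hϖ0 : ϖ ≠ 0 := by
    rintro rfl
    simp at hϖnorm
  have hϖv : padicValRat p ϖ = 0 := by
    have h := Padic.norm_eq_zpow_neg_valuation (show ((ϖ : ℚ) : ℚ_[p]) ≠ 0 by exact_mod_cast hϖ0)
    rw [hϖnorm, Padic.valuation_ratCast] at h
    have hp1 : (1 : ℝ) < p := by exact_mod_cast hpP.one_lt
    have h0 : (p : ℝ) ^ (0 : ℤ) = (p : ℝ) ^ (-padicValRat p ϖ) := by rw [zpow_zero]; exact h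
    have := zpow_right_injective₀ (zero_lt_one.trans hp1) hp1.ne' h0
    omega
  obtain ⟨hX, g, k, hchar, hιg⟩ := hratA κ γ fA hκ hγ hγ' hf D
  obtain ⟨t, htq, hval⟩ := padicValRat_lvalue_add_exponent_of_charIdeal_eq A p hgood hord hL hfin
    (hGr A p hp hgood hord) κ γ hκ hγ hγ' fA hf ϖ hϖeq hϖv D hX g k hchar hιg
  obtain ⟨hrank, hfinp, q', hsha, hvq'⟩ := hbsd
  haveI := hfinp
  have hΩC : (A.realPeriodRat : ℂ) ≠ 0 := Complex.ofReal_ne_zero.mpr A.realPeriodRat_pos_holds.ne'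
  have hT : 0 < A.torsionOrder := A.torsionOrder_pos_holds
  have hc : 0 < A.tamagawaProduct := A.tamagawaProduct_pos'
  have hT0 : (A.torsionOrder : ℚ) ≠ 0 := by exact_mod_cast hT.ne'
  have hc0 : (A.tamagawaProduct : ℚ) ≠ 0 := by exact_mod_cast hc.ne'
  have hr0 : A.mordellWeilRank = 0 := hrank.trans hrA
  have hReg : A.regulator = 1 := A.regulator_eq_one_of_rank_zero hr0
  have hL1 : A.entireLFunction 1 = (t : ℂ) * (A.realPeriodRat : ℂ) := by
    rw [← htq, div_mul_cancel₀ _ hΩC]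
  have ht0 : t ≠ 0 := by
    rintro rfl
    apply hL
    rw [hL1]
    simp
  have hq' : q' = t * (A.torsionOrder : ℚ) ^ 2 / (A.tamagawaProduct : ℚ) := by
    have h : shaAn A = ((t * (A.torsionOrder : ℚ) ^ 2 / (A.tamagawaProduct : ℚ) : ℚ) : ℂ) := by
      rw [shaAn_def, A.leadingLCoeff_eq_of_analyticRank_eq_zero hrA, hL1, hReg]
      have hcC : ((A.tamagawaProduct : ℚ) : ℂ) ≠ 0 := by exact_mod_cast hc.ne'
      push_cast
      field_simp
    rw [hsha] at h
    exact_mod_cast h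
  rw [hq', padicValRat.div (mul_ne_zero ht0 (pow_ne_zero 2 hT0)) hc0,
    padicValRat.mul ht0 (pow_ne_zero 2 hT0), padicValRat.pow,
    padicValNat_card_addPrimaryComponent (A := A.sha) p, padicValRat.of_nat, padicValRat.of_nat] at hvq'
  simp only [WeierstrassCurve.shaOrder] at hval
  simp only [Nat.cast_ofNat] at hvq'
  have hk : k = 0 := by linarith
  rw [hk, zpow_zero, map_one, one_mul] at hιg
  set c : ℤ_[p] := ⟨(ϖ : ℚ_[p]), hϖnorm.le⟩ with hc_def
  have hcu : IsUnit c := PadicInt.isUnit_iff.mpr hϖnorm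
  have hι' : iwasawaToPowerSeries p (PowerSeries.C c * g) =
      PowerSeries.C (ϖ : ℚ_[p]) * padicLFunction fA (unitRoot A p : ℚ_[p]) := by
    rw [map_mul, hιg, PowerSeries.map_C]
    rfl
  refine ⟨hX, PowerSeries.C c * g, ?_, hasUnitContent_of_map_eq _ _ hι' (hcert fA hf ϖ hϖeq), hι'⟩
  rw [hchar]
  exact (Ideal.span_singleton_mul_left_unit (hcu.map PowerSeries.C) g).symm

/-- **Route U2′ at any odd good ordinary prime, analytic rank 0 (no class predicate): `BSD(E,p)`
from a congruent rank-0 partner `A` with `BSD(A,p)` and `μ(𝓛_p(A)) = 0`**, given the rational main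
conjecture for `(A, p)` (`hratA`). PUBLISHED binders `hGr`, `h5`, `h3`, `hGV`, `hmodP`, `hmodL`,
`hGZK`; certificates `hrA`, `hbsdA`, `hcertA`, C1. [cite: GreenbergVatsal2000, Thm. (1.4) (arXiv p. 5)]
[cite: GreenbergLNM1716, Thm. 4.1 (p. 102)] -/
theorem bsdp_of_bsdpPartner_of_rationalMC
    (A : WeierstrassCurve ℚ) [A.IsElliptic] [A.IsGloballyMinimal]
    (hratA : ∀ (κ : ZpExtension ℚ p) (γ : Field.absoluteGaloisGroup ℚ) {N : ℕ} [NeZero N]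
      (f : CuspForm (Gamma0 N) 2), κ.IsCyclotomic → κ.IsTopGenerator γ → IsCyclotomicVariable p γ →
      IsNewformOf A f → ∀ (D : A.SelmerDualData κ γ), D.IsTorsion ∧
        ∃ (g : IwasawaAlgebra p) (k : ℤ), D.charIdeal = Ideal.span {g} ∧
          iwasawaToPowerSeries p g =
            PowerSeries.C ((p : ℚ_[p]) ^ k) * padicLFunction f (unitRoot A p : ℚ_[p]))
    (hGr : greenberg_charValue_rankZero) (h5 : realPeriodRat_eq_unit_mul_plusPeriod)
    (h3 : realPeriodRat_eq_unit_mul_plusPeriod_three)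
    (hGV : GreenbergVatsal2000.thm14_mainConjecture_transfer_of_torsionIso)
    (hmodP : nonempty_modularParametrizationData) (hmodL : hasEntireLFunction_rat)
    (hGZK : rank_eq_analyticRank_of_analyticRank_le_one)
    (hp : p ≠ 2) (hgood : W.HasGoodReductionAtPrime p) (hord : ¬ (p : ℤ) ∣ W.frobeniusTrace p)
    (hirr : W.HasIrreducibleModPGaloisRep p) (hr : W.analyticRank = 0)
    (hgoodA : A.HasGoodReductionAtPrime p) (hordA : ¬ (p : ℤ) ∣ A.frobeniusTrace p)
    (hrA : A.analyticRank = 0) (hbsdA : BSDp A p)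
    (hcertA : ∀ [NeZero (A.conductorNorm ℤ)] (fA : CuspForm (Gamma0 (A.conductorNorm ℤ)) 2),
        IsNewformOf A fA → ∀ (ϖ : ℚ), (ϖ : ℝ) * A.realPeriodRat = plusPeriod fA →
      ∃ n : ℕ, ‖PowerSeries.coeff n
        (PowerSeries.C (ϖ : ℚ_[p]) * padicLFunction fA (unitRoot A p : ℚ_[p]))‖ = 1)
    (hC1 : ∃ e : geomTorsion A (p : ℤ) ≃+ geomTorsion W (p : ℤ),
      ∀ (σ : Field.absoluteGaloisGroup ℚ) (P : geomTorsion A (p : ℤ)), e (σ • P) = σ • e P) :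
    BSDp W p := by
  obtain ⟨e, he⟩ := hC1
  have hirrA : A.HasIrreducibleModPGaloisRep p :=
    hasIrreducibleModPGaloisRep_of_torsionIso_symm e he hirr
  have hL1 : W.entireLFunction 1 ≠ 0 := (W.analyticRank_eq_zero_iff_holds (hmodL W)).1 hr
  exact bsdp_of_pPartRankZero W p hmodL hGZK hr
    (GreenbergVatsal2000.pPartRankZero_of_thm14 A W p hGV hmodP hGZK hp hgoodA hordA hgood hord
      ⟨e, he⟩ hirrA
      (mazurMainConjecture_with_mu_zero_of_bsdp_of_rationalMC p A hratA hGr h5 h3 hmodL hGZK hp hgoodA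
        hordA hirrA hrA hbsdA hcertA)
      hL1 (hGr W p hp hgood hord))

end RationalMC

/-! ### Class X10b (`p = 3`), analytic rank 0 -/

section X10b

variable (W A : WeierstrassCurve ℚ) [W.IsElliptic] [W.IsGloballyMinimal] [A.IsElliptic]
  [A.IsGloballyMinimal] (p : ℕ) [Fact p.Prime]

/-- **Class X10b, analytic rank 0: `BSD(E,3) ⟺ μ(X(E/ℚ_∞)) = 0`**, granted one unit coefficient
of `𝓛_MSD(E)` and the rational main conjecture for `(E, 3)` (`hrat`; Yan–Zhu 2026 Thm. 4.9
supplies it: `YanZhu2026.thm49_charIdeal_eq_padicLFunction`, flag `YZ26@3-BF-ERL-Ohta`), with the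
PUBLISHED inputs `hGr`, `h5`, `h3`, `hmodP`, `hmodL`, `hGZK`. `ClassX10 W p` forces `p = 3`;
`ρ̄_{E,3}` not surjective (`_hns`) is recorded, not used. The typed residue of X10b in rank 0
(`Typed.X10b.MissingInputAt`) IS Greenberg's Conj. 1.11 instance at `3`, pair by pair.
[cite: GreenbergLNM1716, §1 Conj. 1.11 and Thm. 4.1 (p. 102)] [cite: YanZhu2024MainConjNonCM, Thm. 4.9 (§4.4)] -/
theorem X10b.bsdp_iff_mu_eq_zero
    (hrat : ∀ (κ : ZpExtension ℚ p) (γ : Field.absoluteGaloisGroup ℚ) {N : ℕ} [NeZero N]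
      (f : CuspForm (Gamma0 N) 2), κ.IsCyclotomic → κ.IsTopGenerator γ → IsCyclotomicVariable p γ →
      IsNewformOf W f → ∀ (D : W.SelmerDualData κ γ), D.IsTorsion ∧
        ∃ (g : IwasawaAlgebra p) (k : ℤ), D.charIdeal = Ideal.span {g} ∧
          iwasawaToPowerSeries p g =
            PowerSeries.C ((p : ℚ_[p]) ^ k) * padicLFunction f (unitRoot W p : ℚ_[p]))
    (hGr : greenberg_charValue_rankZero) (h5 : realPeriodRat_eq_unit_mul_plusPeriod)
    (h3 : realPeriodRat_eq_unit_mul_plusPeriod_three)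
    (hmodP : nonempty_modularParametrizationData) (hmodL : hasEntireLFunction_rat)
    (hGZK : rank_eq_analyticRank_of_analyticRank_le_one)
    (hX10 : ClassX10 W p) (_hns : ¬ Surj W 3) (hr : W.analyticRank = 0)
    (hcert : ∀ [NeZero (W.conductorNorm ℤ)] (f : CuspForm (Gamma0 (W.conductorNorm ℤ)) 2),
        IsNewformOf W f → ∀ (ϖ : ℚ), (ϖ : ℝ) * W.realPeriodRat = plusPeriod f →
      ∃ n : ℕ, ‖PowerSeries.coeff n
        (PowerSeries.C (ϖ : ℚ_[p]) * padicLFunction f (unitRoot W p : ℚ_[p]))‖ = 1) :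
    BSDp W p ↔
      ∀ (κ : ZpExtension ℚ p) (γ : Field.absoluteGaloisGroup ℚ),
        κ.IsCyclotomic → κ.IsTopGenerator γ → IsCyclotomicVariable p γ →
      ∀ (D : W.SelmerDualData κ γ), D.mu = 0 := by
  obtain ⟨hp3, ⟨hgood, hord⟩, hirr, -⟩ := hX10
  subst hp3
  exact bsdp_iff_mu_eq_zero_of_rationalMC W 3 hrat hGr h5 h3 hmodP hmodL hGZK (by decide) hgood hord
    hirr hr hcert

/-- **Class X10b, analytic rank 0, route U2′: `BSD(E,3)` from a congruent rank-0 partner `A` with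
`BSD(A,3)` and `μ(𝓛_3(A)) = 0`**, given the rational main conjecture for `(A, 3)` (`hratA`;
Yan–Zhu Thm. 4.9). [cite: GreenbergVatsal2000, Thm. (1.4) (arXiv p. 5)] [cite: YanZhu2024MainConjNonCM, Thm. 4.9 (§4.4)] -/
theorem X10b.bsdp_of_bsdpPartner
    (hratA : ∀ (κ : ZpExtension ℚ p) (γ : Field.absoluteGaloisGroup ℚ) {N : ℕ} [NeZero N]
      (f : CuspForm (Gamma0 N) 2), κ.IsCyclotomic → κ.IsTopGenerator γ → IsCyclotomicVariable p γ →
      IsNewformOf A f → ∀ (D : A.SelmerDualData κ γ), D.IsTorsion ∧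
        ∃ (g : IwasawaAlgebra p) (k : ℤ), D.charIdeal = Ideal.span {g} ∧
          iwasawaToPowerSeries p g =
            PowerSeries.C ((p : ℚ_[p]) ^ k) * padicLFunction f (unitRoot A p : ℚ_[p]))
    (hGr : greenberg_charValue_rankZero) (h5 : realPeriodRat_eq_unit_mul_plusPeriod)
    (h3 : realPeriodRat_eq_unit_mul_plusPeriod_three)
    (hGV : GreenbergVatsal2000.thm14_mainConjecture_transfer_of_torsionIso)
    (hmodP : nonempty_modularParametrizationData) (hmodL : hasEntireLFunction_rat)
    (hGZK : rank_eq_analyticRank_of_analyticRank_le_one)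
    (hX10 : ClassX10 W p) (_hns : ¬ Surj W 3) (hr : W.analyticRank = 0)
    (hgoodA : A.HasGoodReductionAtPrime p) (hordA : ¬ (p : ℤ) ∣ A.frobeniusTrace p)
    (hrA : A.analyticRank = 0) (hbsdA : BSDp A p)
    (hcertA : ∀ [NeZero (A.conductorNorm ℤ)] (fA : CuspForm (Gamma0 (A.conductorNorm ℤ)) 2),
        IsNewformOf A fA → ∀ (ϖ : ℚ), (ϖ : ℝ) * A.realPeriodRat = plusPeriod fA →
      ∃ n : ℕ, ‖PowerSeries.coeff n
        (PowerSeries.C (ϖ : ℚ_[p]) * padicLFunction fA (unitRoot A p : ℚ_[p]))‖ = 1)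
    (hC1 : ∃ e : geomTorsion A (p : ℤ) ≃+ geomTorsion W (p : ℤ),
      ∀ (σ : Field.absoluteGaloisGroup ℚ) (P : geomTorsion A (p : ℤ)), e (σ • P) = σ • e P) :
    BSDp W p := by
  obtain ⟨hp3, ⟨hgood, hord⟩, hirr, -⟩ := hX10
  subst hp3
  exact bsdp_of_bsdpPartner_of_rationalMC W 3 A hratA hGr h5 h3 hGV hmodP hmodL hGZK (by decide) hgood
    hord hirr hr hgoodA hordA hrA hbsdA hcertA hC1

/-- **Class X10b, rank 0, route U2′ with a partner of conductor `< 5000` and C1 as the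
Kraus–Oesterlé list: every binder PUBLISHED (incl. Yan–Zhu Thm. 4.9 via `hratA`) or FINITE.**
[cite: KrausOesterle1992, Prop. 4] [cite: Miller2011LMS, Thm. 1.2] [cite: CreutzMiller2012, Thm. 1.1]
[cite: YanZhu2024MainConjNonCM, Thm. 4.9 (§4.4)] -/
theorem X10b.bsdp_of_bsdpPartner_of_conductor_lt
    (hKO : KrausOesterle1992.prop4_torsionIso_of_congruences)
    (hMiller : bsdp_of_irreducible_of_conductor_lt)
    (hratA : ∀ (κ : ZpExtension ℚ p) (γ : Field.absoluteGaloisGroup ℚ) {N : ℕ} [NeZero N]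
      (f : CuspForm (Gamma0 N) 2), κ.IsCyclotomic → κ.IsTopGenerator γ → IsCyclotomicVariable p γ →
      IsNewformOf A f → ∀ (D : A.SelmerDualData κ γ), D.IsTorsion ∧
        ∃ (g : IwasawaAlgebra p) (k : ℤ), D.charIdeal = Ideal.span {g} ∧
          iwasawaToPowerSeries p g =
            PowerSeries.C ((p : ℚ_[p]) ^ k) * padicLFunction f (unitRoot A p : ℚ_[p]))
    (hGr : greenberg_charValue_rankZero) (h5 : realPeriodRat_eq_unit_mul_plusPeriod)
    (h3 : realPeriodRat_eq_unit_mul_plusPeriod_three)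
    (hGV : GreenbergVatsal2000.thm14_mainConjecture_transfer_of_torsionIso)
    (hmodP : nonempty_modularParametrizationData) (hmodL : hasEntireLFunction_rat)
    (hGZK : rank_eq_analyticRank_of_analyticRank_le_one)
    (hX10 : ClassX10 W p) (hns : ¬ Surj W 3) (hr : W.analyticRank = 0)
    (hgoodA : A.HasGoodReductionAtPrime p) (hordA : ¬ (p : ℤ) ∣ A.frobeniusTrace p)
    (hrA : A.analyticRank = 0) (hNA : A.conductorNorm ℤ < 5000)
    (hcertA : ∀ [NeZero (A.conductorNorm ℤ)] (fA : CuspForm (Gamma0 (A.conductorNorm ℤ)) 2),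
        IsNewformOf A fA → ∀ (ϖ : ℚ), (ϖ : ℝ) * A.realPeriodRat = plusPeriod fA →
      ∃ n : ℕ, ‖PowerSeries.coeff n
        (PowerSeries.C (ϖ : ℚ_[p]) * padicLFunction fA (unitRoot A p : ℚ_[p]))‖ = 1)
    (hcong : ∀ (ℓ : ℕ) [Fact ℓ.Prime],
      6 * ℓ < KrausOesterle1992.gammaZeroIndex (KrausOesterle1992.modulus W A) →
      (padicValNat ℓ (W.conductorNorm ℤ * A.conductorNorm ℤ) = 0 →
          (p : ℤ) ∣ W.frobeniusTrace ℓ - A.frobeniusTrace ℓ) ∧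
        (padicValNat ℓ (W.conductorNorm ℤ * A.conductorNorm ℤ) = 1 →
          (p : ℤ) ∣ W.frobeniusTrace ℓ * A.frobeniusTrace ℓ - (ℓ + 1))) :
    BSDp W p := by
  obtain ⟨hp3, -, hirr, -⟩ := id hX10
  have hirr' : W.HasIrreducibleModPGaloisRep p := by subst hp3; exact hirr
  obtain ⟨e, he⟩ := KrausOesterle1992.torsionIso_of_congruences hKO W A p hirr' hcong
  have hirrA : A.HasIrreducibleModPGaloisRep p :=
    hasIrreducibleModPGaloisRep_of_torsionIso_symm e he hirr'
  exact X10b.bsdp_of_bsdpPartner W A p hratA hGr h5 h3 hGV hmodP hmodL hGZK hX10 hns hr hgoodA hordA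
    hrA (hMiller A (by omega) hNA p Fact.out hirrA) hcertA ⟨e, he⟩

/-- **The typed X10b output at a certified rank-0 pair of route U2′**: `Typed.X10b.MissingInputAt W`.
[cite: Miller2011LMS, Def. 1.1] -/
theorem X10b.missingInputAt_of_bsdpPartner
    (hratA : ∀ (κ : ZpExtension ℚ p) (γ : Field.absoluteGaloisGroup ℚ) {N : ℕ} [NeZero N]
      (f : CuspForm (Gamma0 N) 2), κ.IsCyclotomic → κ.IsTopGenerator γ → IsCyclotomicVariable p γ →
      IsNewformOf A f → ∀ (D : A.SelmerDualData κ γ), D.IsTorsion ∧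
        ∃ (g : IwasawaAlgebra p) (k : ℤ), D.charIdeal = Ideal.span {g} ∧
          iwasawaToPowerSeries p g =
            PowerSeries.C ((p : ℚ_[p]) ^ k) * padicLFunction f (unitRoot A p : ℚ_[p]))
    (hGr : greenberg_charValue_rankZero) (h5 : realPeriodRat_eq_unit_mul_plusPeriod)
    (h3 : realPeriodRat_eq_unit_mul_plusPeriod_three)
    (hGV : GreenbergVatsal2000.thm14_mainConjecture_transfer_of_torsionIso)
    (hmodP : nonempty_modularParametrizationData) (hmodL : hasEntireLFunction_rat)
    (hGZK : rank_eq_analyticRank_of_analyticRank_le_one)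
    (hX10 : ClassX10 W p) (hns : ¬ Surj W 3) (hr : W.analyticRank = 0)
    (hgoodA : A.HasGoodReductionAtPrime p) (hordA : ¬ (p : ℤ) ∣ A.frobeniusTrace p)
    (hrA : A.analyticRank = 0) (hbsdA : BSDp A p)
    (hcertA : ∀ [NeZero (A.conductorNorm ℤ)] (fA : CuspForm (Gamma0 (A.conductorNorm ℤ)) 2),
        IsNewformOf A fA → ∀ (ϖ : ℚ), (ϖ : ℝ) * A.realPeriodRat = plusPeriod fA →
      ∃ n : ℕ, ‖PowerSeries.coeff n
        (PowerSeries.C (ϖ : ℚ_[p]) * padicLFunction fA (unitRoot A p : ℚ_[p]))‖ = 1)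
    (hC1 : ∃ e : geomTorsion A (p : ℤ) ≃+ geomTorsion W (p : ℤ),
      ∀ (σ : Field.absoluteGaloisGroup ℚ) (P : geomTorsion A (p : ℤ)), e (σ • P) = σ • e P) :
    Typed.X10b.MissingInputAt W := by
  have h := X10b.bsdp_of_bsdpPartner W A p hratA hGr h5 h3 hGV hmodP hmodL hGZK hX10 hns hr hgoodA hordA
    hrA hbsdA hcertA hC1
  obtain ⟨hp3, -⟩ := id hX10
  subst hp3
  haveI : Finite W.sha := (hGZK W (by omega)).2
  exact Typed.missingPPartAt_of_bsdp W 3 h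

/-! ### Instantiation with Yan–Zhu 2026, Thm. 4.9 (named fact `YanZhu2026.thm49_charIdeal_eq_padicLFunction`, p187100) -/

/-- The pointwise rational main conjecture `hrat` for `(W, p)` at an odd good ordinary irreducible
prime, from the named fact Yan–Zhu 2026 Thm. 4.9 (`p ≥ 3`). [cite: YanZhu2024MainConjNonCM, Thm. 4.9 (§4.4)] -/
theorem rationalMC_of_yanZhu (hYZ : YanZhu2026.thm49_charIdeal_eq_padicLFunction)
    (hp : p ≠ 2) (hgood : W.HasGoodReductionAtPrime p) (hord : ¬ (p : ℤ) ∣ W.frobeniusTrace p)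
    (hirr : W.HasIrreducibleModPGaloisRep p) :
    ∀ (κ : ZpExtension ℚ p) (γ : Field.absoluteGaloisGroup ℚ) {N : ℕ} [NeZero N]
      (f : CuspForm (Gamma0 N) 2), κ.IsCyclotomic → κ.IsTopGenerator γ → IsCyclotomicVariable p γ →
      IsNewformOf W f → ∀ (D : W.SelmerDualData κ γ), D.IsTorsion ∧
        ∃ (g : IwasawaAlgebra p) (k : ℤ), D.charIdeal = Ideal.span {g} ∧
          iwasawaToPowerSeries p g =
            PowerSeries.C ((p : ℚ_[p]) ^ k) * padicLFunction f (unitRoot W p : ℚ_[p]) := by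
  intro κ γ N _ f hκ hγ hγ' hf D
  have hp3 : 3 ≤ p := by
    have := (Fact.out : p.Prime).two_le
    omega
  exact hYZ W p κ γ f hp3 hgood hord hirr hκ hγ hγ' hf D

/-- **Class X10b, analytic rank 0: `BSD(E,3) ⟺ μ(X(E/ℚ_∞)) = 0`, with the rational main conjecture
supplied by Yan–Zhu 2026 Thm. 4.9 (`hYZ`, PUB, flag `YZ26@3-BF-ERL-Ohta`)** — every binder a
PUBLISHED named fact or the finite certificate `hcert`.
[cite: YanZhu2024MainConjNonCM, Thm. 4.9 (§4.4)] [cite: GreenbergLNM1716, §1 Conj. 1.11 and Thm. 4.1 (p. 102)] -/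
theorem X10b.bsdp_iff_mu_eq_zero_of_yanZhu (hYZ : YanZhu2026.thm49_charIdeal_eq_padicLFunction)
    (hGr : greenberg_charValue_rankZero) (h5 : realPeriodRat_eq_unit_mul_plusPeriod)
    (h3 : realPeriodRat_eq_unit_mul_plusPeriod_three)
    (hmodP : nonempty_modularParametrizationData) (hmodL : hasEntireLFunction_rat)
    (hGZK : rank_eq_analyticRank_of_analyticRank_le_one)
    (hX10 : ClassX10 W p) (hns : ¬ Surj W 3) (hr : W.analyticRank = 0)
    (hcert : ∀ [NeZero (W.conductorNorm ℤ)] (f : CuspForm (Gamma0 (W.conductorNorm ℤ)) 2),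
        IsNewformOf W f → ∀ (ϖ : ℚ), (ϖ : ℝ) * W.realPeriodRat = plusPeriod f →
      ∃ n : ℕ, ‖PowerSeries.coeff n
        (PowerSeries.C (ϖ : ℚ_[p]) * padicLFunction f (unitRoot W p : ℚ_[p]))‖ = 1) :
    BSDp W p ↔
      ∀ (κ : ZpExtension ℚ p) (γ : Field.absoluteGaloisGroup ℚ),
        κ.IsCyclotomic → κ.IsTopGenerator γ → IsCyclotomicVariable p γ →
      ∀ (D : W.SelmerDualData κ γ), D.mu = 0 := by
  obtain ⟨hp3, ⟨hgood, hord⟩, hirr, -⟩ := id hX10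
  subst hp3
  exact X10b.bsdp_iff_mu_eq_zero W 3 (rationalMC_of_yanZhu W 3 hYZ (by decide) hgood hord hirr) hGr
    h5 h3 hmodP hmodL hGZK hX10 hns hr hcert

/-- **Class X10b, rank 0, route U2′ with a partner of conductor `< 5000`, the rational main
conjecture for the partner from Yan–Zhu 2026 Thm. 4.9**: every binder PUBLISHED or FINITE.
[cite: YanZhu2024MainConjNonCM, Thm. 4.9 (§4.4)] [cite: KrausOesterle1992, Prop. 4] [cite: CreutzMiller2012, Thm. 1.1] -/
theorem X10b.bsdp_of_bsdpPartner_of_conductor_lt_of_yanZhu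
    (hYZ : YanZhu2026.thm49_charIdeal_eq_padicLFunction)
    (hKO : KrausOesterle1992.prop4_torsionIso_of_congruences)
    (hMiller : bsdp_of_irreducible_of_conductor_lt)
    (hGr : greenberg_charValue_rankZero) (h5 : realPeriodRat_eq_unit_mul_plusPeriod)
    (h3 : realPeriodRat_eq_unit_mul_plusPeriod_three)
    (hGV : GreenbergVatsal2000.thm14_mainConjecture_transfer_of_torsionIso)
    (hmodP : nonempty_modularParametrizationData) (hmodL : hasEntireLFunction_rat)
    (hGZK : rank_eq_analyticRank_of_analyticRank_le_one)
    (hX10 : ClassX10 W p) (hns : ¬ Surj W 3) (hr : W.analyticRank = 0)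
    (hgoodA : A.HasGoodReductionAtPrime p) (hordA : ¬ (p : ℤ) ∣ A.frobeniusTrace p)
    (hrA : A.analyticRank = 0) (hNA : A.conductorNorm ℤ < 5000)
    (hcertA : ∀ [NeZero (A.conductorNorm ℤ)] (fA : CuspForm (Gamma0 (A.conductorNorm ℤ)) 2),
        IsNewformOf A fA → ∀ (ϖ : ℚ), (ϖ : ℝ) * A.realPeriodRat = plusPeriod fA →
      ∃ n : ℕ, ‖PowerSeries.coeff n
        (PowerSeries.C (ϖ : ℚ_[p]) * padicLFunction fA (unitRoot A p : ℚ_[p]))‖ = 1)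
    (hcong : ∀ (ℓ : ℕ) [Fact ℓ.Prime],
      6 * ℓ < KrausOesterle1992.gammaZeroIndex (KrausOesterle1992.modulus W A) →
      (padicValNat ℓ (W.conductorNorm ℤ * A.conductorNorm ℤ) = 0 →
          (p : ℤ) ∣ W.frobeniusTrace ℓ - A.frobeniusTrace ℓ) ∧
        (padicValNat ℓ (W.conductorNorm ℤ * A.conductorNorm ℤ) = 1 →
          (p : ℤ) ∣ W.frobeniusTrace ℓ * A.frobeniusTrace ℓ - (ℓ + 1))) :
    BSDp W p := by
  obtain ⟨hp3, -, hirr, -⟩ := id hX10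
  have hp2 : p ≠ 2 := by omega
  have hirr' : W.HasIrreducibleModPGaloisRep p := by subst hp3; exact hirr
  obtain ⟨e, he⟩ := KrausOesterle1992.torsionIso_of_congruences hKO W A p hirr' hcong
  have hirrA : A.HasIrreducibleModPGaloisRep p :=
    hasIrreducibleModPGaloisRep_of_torsionIso_symm e he hirr'
  exact X10b.bsdp_of_bsdpPartner_of_conductor_lt W A p hKO hMiller
    (rationalMC_of_yanZhu A p hYZ hp2 hgoodA hordA hirrA) hGr h5 h3 hGV hmodP hmodL hGZK hX10 hns hr
    hgoodA hordA hrA hNA hcertA hcong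

end X10b

end Literature.NumberTheory.EllipticCurves.Rank1Residual

end
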